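import Mathlib.Analysis.SpecificLimits.Normed
import Mathlib.Topology.Order.LiminfLimsup
import Literature.Analysis.FluidPDE.SawtoothCascade
import HarnessLib

/-!
# K1loc — helper: THE LAG LEMMA (a growth rate above the pinned rate `r = γ² − 3` buys a FIXED lag `A`)

Helper file of the first prover lane on the crux `K1LocalisedCascade` (stmt-AnomalousDissipation-19491), route
`SawtoothPulseCascade`.  The crux's own `why_might_fail` (rev 8) reads: "the floor `γ²−3` alone gives no FIXED lag `A`
(`tHalf J ~ J⁻⁴` needs `r^{2A} ≳ J⁴`): the proof must use that the bulk of the variance grows at a rate `> γ²−3`".  This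
file records the elementary arithmetic that turns ANY certified per-phase rate `ρ > r` (e.g. the cone floor
`ρ²γ² − 1 − m` of `SawtoothCascadeRobustCones.robustItinGrowth`, `> γ² − 3` for apertures `m < 2`) into a fixed lag:

* `one_le_mul_pow_two_mul_Jrate` — the threshold phase `J_r(κ) = ⌈log(1/κ)/(2 log r)⌉₊` (`SawtoothCascade.Jrate`) satisfies
  `κ · r^{2 J_r(κ)} ≥ 1` (`1 < r`, `0 < κ`);
* `exists_bound_pow_four_mul_pow` — `(n+1)⁴ qⁿ` is bounded for `0 ≤ q < 1`;
* `exists_lag` — **the lag lemma**: for `1 < r < ρ` and every `c > 0` there is `A : ℕ` such that for ALL `κ > 0`, with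
  `J = J_r(κ) + A`, the wavenumber `K = c ρ^J` passes the slot-damping threshold of the registered line `Spectral`:
  `1 ≤ 8π² κ K² · tHalf J` (`CascadeParams.tHalf J = 45/(π⁴(J+1)⁴)`).  Proof: `κ ρ^{2J₀} ≥ (ρ/r)^{2J₀}` by the first item,
  `(J₀+A+1)⁴ ≤ (J₀+1)⁴(A+1)⁴ ≤ M (ρ/r)^{2J₀} (A+1)⁴`, and `(A+1)⁴ ρ^{−2A} → 0` fixes `A`.

So the `J⁻⁴` shrinkage of the phase clock costs only a lag, uniformly in `κ`, as soon as the energy-carrying wavenumber at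
phase `J` is `≥ c ρ^J` with `ρ > r`; the registered stub `stub_highModeConcentration` asks for exactly such a `K` at phase
`J_{γ²−3}(κ) + A`.  WHAT THIS IS NOT: no statement about where the energy is — that is the crux.
[cite: DEIJ2022, (1.2)–(1.3) (κ-uniform dissipation thresholds)] [problem: turb]
-/

-- `Summit.<Summit>.<Problem>`: single-conjunct summit, the duplicate namespace segment is deliberate.
set_option linter.dupNamespace false

noncomputable section

namespace Summit.AnomalousDissipation.AnomalousDissipation.Theorems.SawtoothPulseCascade.K1Lag

open Filter Topology
open Literature.Analysis.FluidPDE.SawtoothCascade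

/-! ## §1 The threshold phase `Jrate` -/

/-- `κ · r^{2 J_r(κ)} ≥ 1`: by the time of the threshold phase `J_r(κ) = ⌈log(1/κ)/(2 log r)⌉₊` the rate-`r` wavenumber
`r^{J}` has reached the diffusive scale `κ^{-1/2}`. [folklore] -/
theorem one_le_mul_pow_two_mul_Jrate {r κ : ℝ} (hr : 1 < r) (hκ : 0 < κ) :
    1 ≤ κ * r ^ (2 * Jrate r κ) := by
  unfold Jrate
  set x : ℝ := Real.log (1 / κ) / (2 * Real.log r) with hx
  have hlogr : 0 < Real.log r := Real.log_pos hr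
  have hceil : x ≤ (⌈x⌉₊ : ℝ) := Nat.le_ceil x
  have hr0 : 0 < r := zero_lt_one.trans hr
  have h1 : Real.log (1 / κ) ≤ (2 * (⌈x⌉₊ : ℝ)) * Real.log r := by
    have hx' : Real.log (1 / κ) = x * (2 * Real.log r) := by
      rw [hx]; field_simp
    rw [hx']
    nlinarith
  have h2 : 1 / κ ≤ r ^ (2 * ⌈x⌉₊) := by
    rw [← Real.exp_log (by positivity : (0 : ℝ) < 1 / κ),
      ← Real.exp_log (by positivity : (0 : ℝ) < r ^ (2 * ⌈x⌉₊)), Real.exp_le_exp, Real.log_pow]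
    push_cast
    exact h1
  calc (1 : ℝ) = κ * (1 / κ) := by field_simp
    _ ≤ κ * r ^ (2 * ⌈x⌉₊) := mul_le_mul_of_nonneg_left h2 hκ.le

/-! ## §2 Polynomial times geometric is bounded -/

/-- `(n+1)⁴ qⁿ ≤ M` for all `n`, for `0 ≤ q < 1`. [folklore] -/
theorem exists_bound_pow_four_mul_pow {q : ℝ} (hq0 : 0 ≤ q) (hq1 : q < 1) :
    ∃ M : ℝ, 0 < M ∧ ∀ n : ℕ, ((n : ℝ) + 1) ^ 4 * q ^ n ≤ M := by
  have ht := tendsto_pow_const_mul_const_pow_of_abs_lt_one 4 (show |q| < 1 by rwa [abs_of_nonneg hq0])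
  obtain ⟨B, hB⟩ := ht.bddAbove_range
  refine ⟨16 * max B 0 + 1, by positivity, fun n => ?_⟩
  have hBn : (n : ℝ) ^ 4 * q ^ n ≤ max B 0 := (hB ⟨n, rfl⟩).trans (le_max_left _ _)
  rcases Nat.eq_zero_or_pos n with rfl | hn
  · simp only [Nat.cast_zero, zero_add, one_pow, pow_zero, mul_one]
    have : 0 ≤ max B 0 := le_max_right _ _
    linarith
  · have hn1 : (1 : ℝ) ≤ n := by exact_mod_cast hn
    have h16 : ((n : ℝ) + 1) ^ 4 ≤ 16 * (n : ℝ) ^ 4 := by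
      have : ((n : ℝ) + 1) ^ 4 ≤ (2 * (n : ℝ)) ^ 4 :=
        pow_le_pow_left₀ (by positivity) (by linarith) 4
      linarith [this, show (2 * (n : ℝ)) ^ 4 = 16 * (n : ℝ) ^ 4 by ring]
    have hqn : 0 ≤ q ^ n := pow_nonneg hq0 n
    calc ((n : ℝ) + 1) ^ 4 * q ^ n ≤ 16 * (n : ℝ) ^ 4 * q ^ n := by gcongr
      _ = 16 * ((n : ℝ) ^ 4 * q ^ n) := by ring
      _ ≤ 16 * max B 0 := by gcongr
      _ ≤ 16 * max B 0 + 1 := by linarith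

/-- Along `atTop`, `(A+1)⁴ q^A → 0` for `0 ≤ q < 1`; hence it is eventually below any positive level. [folklore] -/
theorem exists_pow_four_mul_pow_le {q ε : ℝ} (hq0 : 0 ≤ q) (hq1 : q < 1) (hε : 0 < ε) :
    ∃ A : ℕ, ((A : ℝ) + 1) ^ 4 * q ^ A ≤ ε := by
  -- the limit of `A⁴ q^A` and `(A+1)⁴ ≤ 16 A⁴` for `A ≥ 1`
  have ht := tendsto_pow_const_mul_const_pow_of_abs_lt_one 4 (show |q| < 1 by rwa [abs_of_nonneg hq0])
  have hev : ∀ᶠ A : ℕ in atTop, (A : ℝ) ^ 4 * q ^ A ≤ ε / 16 :=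
    (ht.eventually (ge_mem_nhds (by positivity : (0 : ℝ) < ε / 16))).mono fun A h => h
  obtain ⟨A, hA⟩ := (hev.and (eventually_ge_atTop 1)).exists
  refine ⟨A, ?_⟩
  have hn1 : (1 : ℝ) ≤ A := by exact_mod_cast hA.2
  have h16 : ((A : ℝ) + 1) ^ 4 ≤ 16 * (A : ℝ) ^ 4 := by
    have : ((A : ℝ) + 1) ^ 4 ≤ (2 * (A : ℝ)) ^ 4 := pow_le_pow_left₀ (by positivity) (by linarith) 4
    linarith [this, show (2 * (A : ℝ)) ^ 4 = 16 * (A : ℝ) ^ 4 by ring]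
  have hqA : 0 ≤ q ^ A := pow_nonneg hq0 A
  calc ((A : ℝ) + 1) ^ 4 * q ^ A ≤ 16 * (A : ℝ) ^ 4 * q ^ A := by gcongr
    _ = 16 * ((A : ℝ) ^ 4 * q ^ A) := by ring
    _ ≤ 16 * (ε / 16) := by gcongr; exact hA.1
    _ = ε := by ring

/-! ## §3 The lag lemma -/

/-- **The lag lemma.**  For `1 < r < ρ` and every `c > 0` there is a lag `A : ℕ` such that for ALL `κ > 0`, with
`J = J_r(κ) + A`, the wavenumber `c ρ^J` passes the slot-damping threshold of phase `J`:
`1 ≤ 8π² κ (c ρ^J)² · tHalf J`.  (The `J⁻⁴` of the phase clock is beaten by `(ρ/r)^{2J}`.)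
[cite: DEIJ2022, (1.2)–(1.3) (κ-uniform dissipation thresholds)] -/
theorem exists_lag {r ρ c : ℝ} (hr : 1 < r) (hρ : r < ρ) (hc : 0 < c) :
    ∃ A : ℕ, ∀ κ : ℝ, 0 < κ →
      1 ≤ 8 * Real.pi ^ 2 * κ * (c * ρ ^ (Jrate r κ + A)) ^ 2 * CascadeParams.tHalf (Jrate r κ + A) := by
  have hr0 : 0 < r := zero_lt_one.trans hr
  have hρ0 : 0 < ρ := hr0.trans hρ
  have hρ1 : 1 < ρ := hr.trans hρ
  -- `q = (r/ρ)²` and the bound `(n+1)⁴ qⁿ ≤ M`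
  set q : ℝ := (r / ρ) ^ 2 with hq
  have hq0 : 0 ≤ q := by positivity
  have hq1 : q < 1 := by
    have : r / ρ < 1 := (div_lt_one hρ0).mpr hρ
    have h0 : 0 ≤ r / ρ := by positivity
    calc q = (r / ρ) ^ 2 := hq
      _ < 1 ^ 2 := by gcongr
      _ = 1 := one_pow 2
  obtain ⟨M, hM0, hM⟩ := exists_bound_pow_four_mul_pow hq0 hq1
  -- choose `A` with `(A+1)⁴ (ρ⁻²)^A ≤ 360 c² / (π² M)`
  set q₂ : ℝ := (ρ ^ 2)⁻¹ with hq₂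
  have hq₂0 : 0 ≤ q₂ := by positivity
  have hq₂1 : q₂ < 1 := by
    rw [hq₂]; exact inv_lt_one_of_one_lt₀ (by nlinarith)
  have hπ : 0 < Real.pi := Real.pi_pos
  obtain ⟨A, hA⟩ := exists_pow_four_mul_pow_le hq₂0 hq₂1
    (show 0 < 360 * c ^ 2 / (Real.pi ^ 2 * M) by positivity)
  refine ⟨A, fun κ hκ => ?_⟩
  set J₀ : ℕ := Jrate r κ with hJ₀
  -- F1: `κ r^{2J₀} ≥ 1`
  have hF1 : 1 ≤ κ * r ^ (2 * J₀) := one_le_mul_pow_two_mul_Jrate hr hκ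
  -- F2: `(J₀+1)⁴ ≤ M κ ρ^{2J₀}`
  have hqJ : q ^ J₀ * ρ ^ (2 * J₀) = r ^ (2 * J₀) := by
    rw [hq, ← pow_mul, div_pow, pow_mul, pow_mul, div_mul_cancel₀]
    exact pow_ne_zero _ (pow_ne_zero _ hρ0.ne')
  have hF2 : ((J₀ : ℝ) + 1) ^ 4 ≤ M * (κ * ρ ^ (2 * J₀)) := by
    have h1 : ((J₀ : ℝ) + 1) ^ 4 * q ^ J₀ ≤ M := hM J₀
    have hqpos : 0 < q ^ J₀ := pow_pos (by positivity) J₀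
    -- `1 ≤ κ r^{2J₀} = κ q^{J₀} ρ^{2J₀}`
    have h2 : 1 ≤ q ^ J₀ * (κ * ρ ^ (2 * J₀)) := by
      calc (1 : ℝ) ≤ κ * r ^ (2 * J₀) := hF1
        _ = q ^ J₀ * (κ * ρ ^ (2 * J₀)) := by rw [← hqJ]; ring
    calc ((J₀ : ℝ) + 1) ^ 4 = ((J₀ : ℝ) + 1) ^ 4 * 1 := (mul_one _).symm
      _ ≤ ((J₀ : ℝ) + 1) ^ 4 * (q ^ J₀ * (κ * ρ ^ (2 * J₀))) := by gcongr
      _ = (((J₀ : ℝ) + 1) ^ 4 * q ^ J₀) * (κ * ρ ^ (2 * J₀)) := by ring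
      _ ≤ M * (κ * ρ ^ (2 * J₀)) := by gcongr
  -- F3: the choice of `A`: `π² M (A+1)⁴ ≤ 360 c² ρ^{2A}`
  have hF3 : Real.pi ^ 2 * M * ((A : ℝ) + 1) ^ 4 ≤ 360 * c ^ 2 * ρ ^ (2 * A) := by
    have hρA : 0 < ρ ^ (2 * A) := by positivity
    have h1 : ((A : ℝ) + 1) ^ 4 * q₂ ^ A * (Real.pi ^ 2 * M) ≤ 360 * c ^ 2 := by
      have := mul_le_mul_of_nonneg_right hA (show 0 ≤ Real.pi ^ 2 * M by positivity)
      rwa [div_mul_cancel₀ _ (by positivity : Real.pi ^ 2 * M ≠ 0)] at this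
    have h2 : q₂ ^ A * ρ ^ (2 * A) = 1 := by
      rw [hq₂, pow_mul, ← mul_pow, inv_mul_cancel₀ (pow_ne_zero _ hρ0.ne'), one_pow]
    calc Real.pi ^ 2 * M * ((A : ℝ) + 1) ^ 4
        = (((A : ℝ) + 1) ^ 4 * q₂ ^ A * (Real.pi ^ 2 * M)) * ρ ^ (2 * A) := by
          rw [show ((A : ℝ) + 1) ^ 4 * q₂ ^ A * (Real.pi ^ 2 * M) * ρ ^ (2 * A) =
            ((A : ℝ) + 1) ^ 4 * (Real.pi ^ 2 * M) * (q₂ ^ A * ρ ^ (2 * A)) by ring, h2, mul_one]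
          ring
      _ ≤ 360 * c ^ 2 * ρ ^ (2 * A) := mul_le_mul_of_nonneg_right h1 hρA.le
  -- combine: `π² (J₀+A+1)⁴ ≤ 360 c² ρ^{2A} · κ ρ^{2J₀}`
  have hsplit : ((J₀ : ℝ) + A + 1) ^ 4 ≤ ((J₀ : ℝ) + 1) ^ 4 * ((A : ℝ) + 1) ^ 4 := by
    rw [← mul_pow]
    exact pow_le_pow_left₀ (by positivity) (by nlinarith [(Nat.cast_nonneg J₀ : (0:ℝ) ≤ J₀),
      (Nat.cast_nonneg A : (0:ℝ) ≤ A)]) 4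
  have hκρ : 0 ≤ κ * ρ ^ (2 * J₀) := by positivity
  have key : Real.pi ^ 2 * ((J₀ : ℝ) + A + 1) ^ 4 ≤ 360 * c ^ 2 * ρ ^ (2 * A) * (κ * ρ ^ (2 * J₀)) :=
    calc Real.pi ^ 2 * ((J₀ : ℝ) + A + 1) ^ 4 ≤ Real.pi ^ 2 * (((J₀ : ℝ) + 1) ^ 4 * ((A : ℝ) + 1) ^ 4) := by
          gcongr
      _ ≤ Real.pi ^ 2 * ((M * (κ * ρ ^ (2 * J₀))) * ((A : ℝ) + 1) ^ 4) := by gcongr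
      _ = (Real.pi ^ 2 * M * ((A : ℝ) + 1) ^ 4) * (κ * ρ ^ (2 * J₀)) := by ring
      _ ≤ 360 * c ^ 2 * ρ ^ (2 * A) * (κ * ρ ^ (2 * J₀)) := mul_le_mul_of_nonneg_right hF3 hκρ
  -- rewrite the goal
  have hden : 0 < Real.pi ^ 4 * (((J₀ + A : ℕ) : ℝ) + 1) ^ 4 := by positivity
  unfold CascadeParams.tHalf
  rw [show 8 * Real.pi ^ 2 * κ * (c * ρ ^ (J₀ + A)) ^ 2 * (45 / (Real.pi ^ 4 * (((J₀ + A : ℕ) : ℝ) + 1) ^ 4)) =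
      (360 * c ^ 2 * ρ ^ (2 * A) * (κ * ρ ^ (2 * J₀)) * Real.pi ^ 2) /
        (Real.pi ^ 4 * (((J₀ + A : ℕ) : ℝ) + 1) ^ 4) by
    rw [pow_add, mul_comm (2 : ℕ) A, mul_comm (2 : ℕ) J₀, pow_mul, pow_mul]; ring]
  rw [le_div_iff₀ hden, one_mul]
  push_cast
  have hπ2 : 0 < Real.pi ^ 2 := by positivity
  calc Real.pi ^ 4 * ((J₀ : ℝ) + (A : ℝ) + 1) ^ 4 = Real.pi ^ 2 * (Real.pi ^ 2 * ((J₀ : ℝ) + A + 1) ^ 4) := by ring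
    _ ≤ Real.pi ^ 2 * (360 * c ^ 2 * ρ ^ (2 * A) * (κ * ρ ^ (2 * J₀))) := by gcongr
    _ = 360 * c ^ 2 * ρ ^ (2 * A) * (κ * ρ ^ (2 * J₀)) * Real.pi ^ 2 := by ring

end Summit.AnomalousDissipation.AnomalousDissipation.Theorems.SawtoothPulseCascade.K1Lag
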